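import Summits.QuantumFields.YangMills.Theorems.BalabanUVNodesN11Thm2Ineq249AtRecord13CoPHWindow
import Summits.QuantumFields.YangMills.Theorems.BalabanUVNodesN11Thm2RSideAtRecord13CoPH
import Summits.QuantumFields.YangMills.Theorems.BalabanUVNodesN11Thm2ESideAtRecord13CoPH
import Summits.QuantumFields.YangMills.Theorems.BalabanUVNodesN11Thm2BSideAtRecord13CoPH

/-!
# DAG node N11 — (2.49) FOR THE EFFECTIVE ACTION OF RECORD FROM [III]'s §3-LEVEL SENTENCES ONLY, at NODE 00's Stage-13 objects (v1.7 `CoPH`): the 𝐄-side per point ((3.67) +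
# (3.65)), the 𝐑-side per domain (p. 283, with [II] (1.26) on the torus DISCHARGED), the 𝐁-side per class ((2.47)), the vacuum sentence, and the β-window letters ((2.46) DISCHARGED)

Cell `pub-ymgap`, YM-PLAN Track A (HUMAN RULING D-0062 ∕ D-0149), seat `pub-ymgap-dag-n11-w2` (g0), route `BalabanUVNodes`, key item K1⁷ `StabilityBAtRecordR13SepCoPH` =
stmt-QuantumFields-20542 (helper, count-neutral).  CAPSTONE of this seat's five files: `…Thm2Ineq249AtRecord13CoPH` (Theorem 2's sentences (2.43)_j∕(2.44)_j at the (2.23)-data of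
record ⇒ (2.49)), `…Window` ((2.46)'s coupling inputs from the window letters), `…Thm2ESideAtRecord13CoPH` ((2.43)_j ⇐ (3.67) per point), `…Thm2RSideAtRecord13CoPH` ((2.44)_j ⇐
p. 283 per domain + (1.26) torus), `…Thm2BSideAtRecord13CoPH` ((2.48) ⇐ (2.47) per class).  [III] = [Balaban1988Convergent], [II] = [Balaban1988RG2Cluster], [I] = [Balaban1987RG1].

WHAT THIS FILE PROVES (0 `sorry`, 0 `def`, standard axioms; count-neutral; nothing of Bałaban's asserted — every §3-level sentence is a HYPOTHESIS, displayed).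
§0 `bounds245to249_concrete_of_thm2PerScale` ((2.48)'s `2B₁` is `B14Thm2`'s normalisation of the printed line, referee ref-M READ-8 NIT 1) · ((2.45)∕(2.46)∕(2.48) as `B14.Bounds245to249` for the totals of r11's concrete data from Theorem 2's per-scale sentences — the `hB` leaf of
`B16Cor3ActionBounds.uvIneq_of_repr172_torus_of_223` in its letter) · `eq223_action23_at_record₁₃CoPH` ((2.23) of record as `Eq223`, the `h223` leaf's letter).
§0b A6 (ref-M READ-8 NIT 3): `smearedWilson_unit` · `EjSub_unit` · `rSummand_unit` · `thm2Binders_inhabited_at_unit` (the binders jointly hold at `U = 1`, zero boundary terms, zero constants ∕ volumes).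
★★★ `ineq249_action23_at_record₁₃CoPH_of_sect3Sentences` — for a run `p`, a history `s`, an exposed §2 witness `t`, fluctuation argument `a`, constant `E_k = EkLog + EkRest`,
configuration `U`, volume majorants `Γ_n ≥ 0`: FROM (𝐄) per scale `j ∈ [1,k]` a point support `Z_j`, a partition `φ_j = Σ_{z∈Z_j} h_{j,z}` ((3.65)), scales `n_z ∈ [j,k]`, (3.67) per
point with constant `cE` and exponent `5 − b` (`0 < 1 − b`), the p. 263 count; (𝐑) per scale a chosen cube `pick_j X ∈ X` with scale in `[j,k]`, p. 283's per-domain bound with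
constant `cR`, decay rate `κ ≥ κ₀(4·2^d, 2d)`, the cube count; (𝐁) a class map and (2.47) per class with `0 ≤ V_n ≤ Γ_n`; the vacuum sentence `|EkRest| ≤ E₂ΣΓ`; the window letters
`(genFlow (betaOfRecord₁₃ …) p.g0).InInterval γ K′`, `b′ ≤ g_j^{−2} − g_{j+1}^{−2}`, `γ⁴ ≤ b′`, `γ ≤ ½`, `(cR·K₀)·γ^{κ₀−6} ≤ 1`, `k ≤ K′`, κ₀ ≥ 7, L > 1 — TO
`B14Thm2.Ineq249 ((sect2ActionDataOfRecord … s t a E_k).action23 k U) (A(1∕g_k²(·),U)) (−EkLog) (cE(1−L^{−(1−b)})⁻¹ + 1 + 2B₁ + E₂) Γ k`.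
★★ `action23_at_record₁₃CoPH_le_of_sect3Sentences` — its constant-coupling upper half (`−(1∕g_k²)·A(U)`), adding only `φ_j ≤ 1`.

HONEST FRAMING.  Composition of the five files; what remains hypothesis is exactly [III] §3's analytic content at the objects of record ((3.67) per point; the (3.44)–(3.49) chain with
𝐑^{(2)} per domain; (2.47) per class; the vacuum sentence) plus the DAG's unprinted β lower bound (T09.F) and print's smallness of `g` — nobody's theorems in the tree.  The junction
to the Cor.-3 chain's `h249` (its (1.72) action `R.A'` vs r11's (2.23) `action23`, and «the logarithmic terms») stays N13's ∕ def-T's.  N11 NOT discharged; K1⁷ NOT closed; counts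
unmoved (typed 28∕28 · discharged 5∕27).  One finite four-torus programme at fixed `ε = L^{−K}`; R4 closes only the conditional finite-𝕋⁴ rung `BalabanLadder.UV`; NOT ℝ⁴, NOT OS,
NOT a mass gap, NOT Clay.  Sources: [III] (2.43)–(2.49) pp. 263–264, (3.65)–(3.67) p. 283, p. 283 (𝐑-side), (2.23)–(2.30) pp. 258–260, (2.40)–(2.41) p. 261; [II] (1.26) p. 8; [I] (0.20) p. 256.
-/

noncomputable section

open scoped BigOperators Matrix.Norms.L2Operator

namespace Summit.QuantumFields.YangMills.Theorems.BalabanUVNodesN11Thm2Ineq249AtRecord13CoPHOfSect3Sentences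

open Literature.MathematicalPhysics.QuantumFieldTheory.Balaban1983to89 Step B12TreeDecay TreeLengthTorus B14.Eq225Concrete B14.LocalCoupling B14Thm2 Finset
open T4Continuum Node00
open FlowStepRuns (genFlow)
open BalabanUVNodesN11Thm2Ineq249AtRecord13CoPHWindow (ineq249_action23_at_record₁₃CoPH_of_thm2_of_window action23_at_record₁₃CoPH_le_of_thm2_of_window)
open BalabanUVNodesN11Thm2RSideAtRecord13CoPH (h244_at_record₁₃CoPH_of_perDomain)
open BalabanUVNodesN11Thm2ESideAtRecord13CoPH (h243_at_record₁₃CoPH_of_perPoint)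
open BalabanUVNodesN11Thm2BSideAtRecord13CoPH (h248_at_record₁₃CoPH_of_ineq247)

/-! ## §0. The (2.23)-level leaves in the Cor.-3 chain's letter (`B16Cor3ActionBounds.uvIneq_of_repr172_torus_of_223` reads `Eq223` + `B14.Bounds245to249`):
Theorem 2's per-scale sentences ⇒ `Bounds245to249` for the (2.25)∕(2.30)∕(2.40) totals of r11's concrete data, and (2.23) of record as `Eq223` -/

section Leaves223

variable {P : Params} {G : Type*} [GaugeGroup G] {Φ 𝒢 𝔄 : Type*}
variable (T : LFTower P G Φ 𝒢 𝔄) (admE : (j : ℕ) → (T.sys j).Dom → T.Pt j → Bool) (admR admB : (j : ℕ) → (T.sys j).Dom → Bool)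
  (φ : ℕ → Plaq P 0 → ℝ)

/-- **(2.45), (2.46), (2.48) IN THE SHAPE `B14.Bounds245to249` FOR THE TOTALS OF r11's CONCRETE DATA** from Theorem 2's per-scale sentences (2.43)_j ∕ (2.44)_j at the (2.25)∕(2.30)
summands, (2.48) on `B240`, and (2.46)'s located coupling inputs — the `hB` leaf of `B16Cor3ActionBounds.uvIneq_of_repr172_torus_of_223` in its own letter (totals `𝐄_k = Σ_j e_j`,
`𝐑_k = Σ_j r_j`, `𝐁_k = B240`). [cite: Balaban1988Convergent, (2.43)–(2.48) pp.263–264] -/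
theorem bounds245to249_concrete_of_thm2PerScale (k κ₀ : ℕ) (a : 𝔄) (U : GaugeField P 0 G) (E₁ R₁ B₁ L β : ℝ) (Γ : ℕ → ℝ)
    (hL : 1 < L) (hβ : 0 < β) (hE : 0 ≤ E₁) (hR : 0 ≤ R₁) (hΓ : ∀ n, 1 ≤ n → n ≤ k → 0 ≤ Γ n)
    (h243 : ∀ j, 1 ≤ j → j ≤ k →
      |EjSub T admE j U - T.flow.β j (T.flow.g (j - 1)) * smearedWilson (φ j) U| ≤ E₁ * ∑ n ∈ Icc j k, (L ^ ((j : ℝ) - n)) ^ β * Γ n)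
    (h244 : ∀ j, 1 ≤ j → j ≤ k →
      |∑ X : (T.sys j).Dom, (if admR j X then ((T.R j X (T.ofBackground U)).re - (T.R j X (T.ofBackground 1)).re) else 0)| ≤
        R₁ * (T.flow.g j) ^ κ₀ * ∑ n ∈ Icc j k, Γ n)
    (hsum : ∀ n, 1 ≤ n → n ≤ k → ∑ j ∈ Icc 1 n, (T.flow.g j) ^ κ₀ ≤ (T.flow.g n) ^ (κ₀ - 6))
    (hsmall : ∀ n, 1 ≤ n → n ≤ k → R₁ * (T.flow.g n) ^ (κ₀ - 6) ≤ 1)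
    (h248 : |B240 T admB a k U| ≤ 2 * B₁ * ∑ n ∈ Icc 1 k, Γ n) :
    B14.Bounds245to249 (∑ j ∈ Icc 1 k, (EjSub T admE j U - T.flow.β j (T.flow.g (j - 1)) * smearedWilson (φ j) U))
      (∑ j ∈ Icc 1 k, ∑ X : (T.sys j).Dom, (if admR j X then ((T.R j X (T.ofBackground U)).re - (T.R j X (T.ofBackground 1)).re) else 0))
      (B240 T admB a k U) E₁ R₁ B₁ L β T.flow.g κ₀ Γ k := by
  refine ⟨?_, fun _ => ?_, h248⟩
  · obtain ⟨h1, h2⟩ := bound245_of_243 k (fun j => EjSub T admE j U - T.flow.β j (T.flow.g (j - 1)) * smearedWilson (φ j) U)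
      Γ E₁ L β hL hβ hE hΓ h243
    exact le_trans h1 h2
  · exact bound246_of_244 k κ₀ _ Γ T.flow.g R₁ hR hΓ h244 hsum hsmall

end Leaves223

/-! ## §0b. A6 (referee dag-ref-M READ-8 NIT 3, exhibited): the displayed Theorem-2 ∕ (2.48) binders are jointly satisfiable — at the unit configuration every vacuum-subtracted 𝐄 ∕ 𝐑
summand and every `A(φ, 1)` vanish (any tower), and at the ZERO term values the boundary sum vanishes too, so `h243 ∕ h244 ∕ h248` hold with `E₁ = R₁ = B₁ = 0`, `Γ ≡ 0` -/

section A6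

variable {P : Params} {G : Type*} [GaugeGroup G] {Φ 𝒢 𝔄 : Type*}

/-- `A(w, 1) = 0` for every plaquette weight: the unit field has unit holonomy and `Re tr 1 = 1` (`GaugeGroup.reTr_one`). [cite: Balaban1988Convergent, (2.25) p.259 (bookkeeping)] -/
theorem smearedWilson_unit (w : Plaq P 0 → ℝ) : smearedWilson w (1 : GaugeField P 0 G) = 0 := by
  unfold smearedWilson
  refine Finset.sum_eq_zero fun q _ => ?_
  have e : ∀ b : PBond P 0, (1 : GaugeField P 0 G) b = 1 := fun _ => rfl
  have h1 : GaugeField.plaqHol (1 : GaugeField P 0 G) q = 1 := by simp only [GaugeField.plaqHol, e, inv_one, mul_one]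
  rw [h1, GaugeGroup.reTr_one, sub_self, mul_zero]

variable (T : LFTower P G Φ 𝒢 𝔄) (admE : (j : ℕ) → (T.sys j).Dom → T.Pt j → Bool) (admR admB : (j : ℕ) → (T.sys j).Dom → Bool)

/-- At `U = 1` the vacuum-subtracted (2.25) summand vanishes (any tower, any range). [cite: Balaban1988Convergent, (2.25) p.259 (bookkeeping)] -/
theorem EjSub_unit (j : ℕ) : EjSub T admE j (1 : GaugeField P 0 G) = 0 := by
  unfold EjSub
  refine Finset.sum_eq_zero fun X _ => Finset.sum_eq_zero fun z _ => ?_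
  split_ifs <;> simp

/-- At `U = 1` the vacuum-subtracted (2.30) summand vanishes (any tower, any range). [cite: Balaban1988Convergent, (2.30) p.260 (bookkeeping)] -/
theorem rSummand_unit (j : ℕ) :
    ∑ X : (T.sys j).Dom, (if admR j X then ((T.R j X (T.ofBackground (1 : GaugeField P 0 G))).re - (T.R j X (T.ofBackground 1)).re) else 0) = 0 := by
  refine Finset.sum_eq_zero fun X _ => ?_
  split_ifs <;> simp

/-- **A6 — THE BINDERS OF §0∕file 1 JOINTLY INHABITED** at `U = 1`, zero boundary terms (`hB0`: e.g. the zero term values `Sect2.TermValues.zero`), `E₁ = R₁ = B₁ = 0`, `Γ ≡ 0`: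
`h243`, `h244`, `h248` all hold (each side is `0`).  ((2.46)'s coupling inputs `hsum`∕`hsmall` are sentences about the couplings alone — e.g. a constant `g` with `k·g⁶ ≤ 1`, κ₀ = 7 —
and the vacuum binder holds at `EkRest = 0`.)  No conclusion of this seat's files is vacuous by contradiction. [cite: Balaban1988Convergent, (2.43)–(2.48) pp.263–264 (bookkeeping)] -/
theorem thm2Binders_inhabited_at_unit (φ : ℕ → Plaq P 0 → ℝ) (k κ₀ : ℕ) (a : 𝔄) (L β : ℝ)
    (hB0 : ∀ j X φ' a', T.B j X φ' a' = 0) :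
    (∀ j, 1 ≤ j → j ≤ k → |EjSub T admE j (1 : GaugeField P 0 G) - T.flow.β j (T.flow.g (j - 1)) * smearedWilson (φ j) (1 : GaugeField P 0 G)| ≤
        0 * ∑ n ∈ Icc j k, (L ^ ((j : ℝ) - n)) ^ β * (0 : ℝ)) ∧
      (∀ j, 1 ≤ j → j ≤ k →
        |∑ X : (T.sys j).Dom, (if admR j X then ((T.R j X (T.ofBackground (1 : GaugeField P 0 G))).re - (T.R j X (T.ofBackground 1)).re) else 0)| ≤
          0 * (T.flow.g j) ^ κ₀ * ∑ _n ∈ Icc j k, (0 : ℝ)) ∧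
      |B240 T admB a k (1 : GaugeField P 0 G)| ≤ 2 * 0 * ∑ _n ∈ Icc 1 k, (0 : ℝ) := by
  refine ⟨fun j _ _ => ?_, fun j _ _ => ?_, ?_⟩
  · rw [EjSub_unit, smearedWilson_unit]; simp
  · rw [rSummand_unit]; simp
  · have hB : B240 T admB a k (1 : GaugeField P 0 G) = 0 := by
      unfold B240
      refine Finset.sum_eq_zero fun j _ => Finset.sum_eq_zero fun X _ => ?_
      split_ifs <;> simp [hB0]
    rw [hB]; simp

end A6

section Eq223AtRecord

variable {F : T4Family} {N : ℕ} [NeZero N]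
variable (θ : Stage13HParams F N) (p : B12.RunParams) {k : ℕ}

/-- **(2.23) OF RECORD AS `Eq223`** (the `h223` leaf's letter, for the (2.23)-action of record at `settingOfRecord₁₃`∕`θ.rzAt p s`): `A_k(s)(U) = −A(1∕g_k²(·),U) + Σ_j e_j + Σ_j r_j + 𝐁_k − E_k`
with the (2.25)∕(2.30) summands of the witness and `B240`; `rfl` through `eq223_action23_concrete`. [cite: Balaban1988Convergent, (2.23)–(2.25) pp.258–259, (2.30) p.260, (2.40) p.261] -/
theorem eq223_action23_at_record₁₃CoPH (s : SeqOfRecord F θ.ν θ.τ9.M (gOfRecord₁₃ F N θ.toStage13Params p) p.K k)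
    (t : Sect2.TermValues (F.P p.K) (MatA N) (FluctV N) θ.τ9.M) (a : Tk.SFluct (F.P p.K) (FluctV N)) (Ek : ℝ) (U : GaugeField (F.P p.K) 0 (SU N)) :
    Eq223 ((sect2ActionDataOfRecord F N (FluctV N) p.K (settingOfRecord₁₃ F N θ.toStage13Params p) (θ.rzAt p s) s t a Ek).action23 k U)
      (smearedWilson (invSq (flowOfRun (gOfRecord₁₃ F N θ.toStage13Params p)) (θ.Phih p k s.Ω s.Λ) k) U)
      (∑ j ∈ Icc 1 k, (EjSub (sect2TowerOfRecord F N (FluctV N) p.K (settingOfRecord₁₃ F N θ.toStage13Params p) (θ.rzAt p s) s t)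
          (fun j X z => Sect2.admE (F.P p.K) θ.ν θ.τ9.M (gOfRecord₁₃ F N θ.toStage13Params p) s.Λ j (Sect2.domSites (F.P p.K) θ.τ9.M j X) z) j U
        - (1 / gOfRecord₁₃ F N θ.toStage13Params p (j - 1) ^ 2 - 1 / gOfRecord₁₃ F N θ.toStage13Params p j ^ 2) * smearedWilson (θ.Phih p k s.Ω s.Λ j) U))
      (∑ j ∈ Icc 1 k, ∑ X : (Sect2.domSys (F.P p.K) θ.τ9.M j).Dom,
        (if Sect2.admR (F.P p.K) θ.ν θ.τ9.M (gOfRecord₁₃ F N θ.toStage13Params p) s.Λ j (Sect2.domSites (F.P p.K) θ.τ9.M j X) then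
          ((t.R j X (Sect2.ofBackgroundC (ιSU N) U)).re - (t.R j X (Sect2.ofBackgroundC (ιSU N) 1)).re) else 0))
      (B240 (sect2TowerOfRecord F N (FluctV N) p.K (settingOfRecord₁₃ F N θ.toStage13Params p) (θ.rzAt p s) s t)
        (fun j X => Sect2.admB (F.P p.K) θ.ν θ.τ9.M (gOfRecord₁₃ F N θ.toStage13Params p) s.Ω s.Λ j (Sect2.domSites (F.P p.K) θ.τ9.M j X)) a k U) Ek :=
  BalabanUVNodesN11Thm2Ineq249AtRecord13CoPH.eq223_action23_concrete (sect2TowerOfRecord F N (FluctV N) p.K (settingOfRecord₁₃ F N θ.toStage13Params p) (θ.rzAt p s) s t)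
    _ _ _ (θ.Phih p k s.Ω s.Λ) k a Ek U

end Eq223AtRecord

variable {F : T4Family} {N : ℕ} [NeZero N]
variable (θ : Stage13HParams F N) (p : B12.RunParams) {k : ℕ}

/-- **★★★ (2.49) FOR THE (2.23)-ACTION OF RECORD FROM [III]'s §3-LEVEL SENTENCES ONLY** (see the module docstring for the list; every binder displayed; (1.26) on the torus and (2.46)'s
coupling inputs are DISCHARGED inside). [cite: Balaban1988Convergent, (2.43)–(2.49) pp.263–264, (3.65)–(3.67) p.283, p.283; Balaban1988RG2Cluster, (1.26) p.8; Balaban1987RG1, (0.20) p.256] -/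
theorem ineq249_action23_at_record₁₃CoPH_of_sect3Sentences (s : SeqOfRecord F θ.ν θ.τ9.M (gOfRecord₁₃ F N θ.toStage13Params p) p.K k)
    (t : Sect2.TermValues (F.P p.K) (MatA N) (FluctV N) θ.τ9.M) (a : Tk.SFluct (F.P p.K) (FluctV N)) (κ₀ : ℕ) (hκ : 7 ≤ κ₀)
    (Ek EkLog EkRest : ℝ) (hEk : Ek = EkLog + EkRest) (U : GaugeField (F.P p.K) 0 (SU N)) (cE cR B₁ L b E₂ : ℝ) (Γ : ℕ → ℝ)
    (hL : 1 < L) (hb : b < 1) (hcE : 0 ≤ cE) (hcR : 0 ≤ cR) (hB : 0 ≤ B₁) (hΓ : ∀ n, 1 ≤ n → n ≤ k → 0 ≤ Γ n)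
    -- the window letters ((2.46)'s inputs; `R₁ = cR·K₀(4·2^d, 2d)`)
    {γ b' : ℝ} {K' : ℕ} (hb' : 0 < b') (hγ4 : γ ^ 4 ≤ b') (hγ2 : γ ≤ 1 / 2)
    (hRγ : (cR * K₀ (4 * 2 ^ (F.P p.K).d) (2 * (F.P p.K).d)) * γ ^ (κ₀ - 6) ≤ 1)
    (hI : (genFlow (betaOfRecord₁₃ F N θ.toStage13Params) p.g0).InInterval γ K')
    (hlb : ∀ j, j < K' → b' ≤ 1 / gOfRecord₁₃ F N θ.toStage13Params p j ^ 2 - 1 / gOfRecord₁₃ F N θ.toStage13Params p (j + 1) ^ 2) (hk : k ≤ K')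
    -- (𝐄) (3.65) + (3.67) per point + the p. 263 count, per scale j
    (Z : (j : ℕ) → Finset (Site (F.P p.K) j)) (h : (j : ℕ) → Site (F.P p.K) j → Plaq (F.P p.K) 0 → ℝ)
    (hφ : ∀ j, 1 ≤ j → j ≤ k → ∀ q, θ.Phih p k s.Ω s.Λ j q = ∑ z ∈ Z j, h j z q)
    (hZ : ∀ j, 1 ≤ j → j ≤ k → ∀ z, z ∉ Z j → ∀ X, Sect2.admE (F.P p.K) θ.ν θ.τ9.M (gOfRecord₁₃ F N θ.toStage13Params p) s.Λ j (Sect2.domSites (F.P p.K) θ.τ9.M j X) z = false)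
    (scE : (j : ℕ) → Site (F.P p.K) j → ℕ) (hscE : ∀ j, 1 ≤ j → j ≤ k → ∀ z ∈ Z j, j ≤ scE j z ∧ scE j z ≤ k)
    (h367 : ∀ j, 1 ≤ j → j ≤ k → ∀ z ∈ Z j, |(∑ X : (Sect2.domSys (F.P p.K) θ.τ9.M j).Dom,
        (if Sect2.admE (F.P p.K) θ.ν θ.τ9.M (gOfRecord₁₃ F N θ.toStage13Params p) s.Λ j (Sect2.domSites (F.P p.K) θ.τ9.M j X) z then
          ((t.E j X z (gOfRecord₁₃ F N θ.toStage13Params p (j - 1)) (Sect2.ofBackgroundC (ιSU N) U)).re -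
            (t.E j X z (gOfRecord₁₃ F N θ.toStage13Params p (j - 1)) (Sect2.ofBackgroundC (ιSU N) 1)).re) else 0))
        - (1 / gOfRecord₁₃ F N θ.toStage13Params p (j - 1) ^ 2 - 1 / gOfRecord₁₃ F N θ.toStage13Params p j ^ 2) * smearedWilson (h j z) U| ≤
        cE * (L ^ ((j : ℝ) - scE j z)) ^ (5 - b))
    (hcountE : ∀ j, 1 ≤ j → j ≤ k → ∀ n, (((Z j).filter (fun z => scE j z = n)).card : ℝ) ≤ (L ^ ((n : ℝ) - j)) ^ (4 : ℝ) * Γ n)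
    -- (𝐑) p. 283 per domain + the cube count, per scale j; (1.26) on the torus needs κ ≥ κ₀(4·2^d, 2d)
    {κ : ℝ} (hκR : kappa₀ (4 * 2 ^ (F.P p.K).d) (2 * (F.P p.K).d) ≤ κ)
    (pick : (j : ℕ) → (Sect2.domSys (F.P p.K) θ.τ9.M j).Dom → TPt (F.P p.K).d (Sect2.domCount (F.P p.K) θ.τ9.M j))
    (hpick : ∀ j, 1 ≤ j → j ≤ k → ∀ X, Sect2.admR (F.P p.K) θ.ν θ.τ9.M (gOfRecord₁₃ F N θ.toStage13Params p) s.Λ j (Sect2.domSites (F.P p.K) θ.τ9.M j X) = true → pick j X ∈ X.1)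
    (scR : (j : ℕ) → TPt (F.P p.K).d (Sect2.domCount (F.P p.K) θ.τ9.M j) → ℕ)
    (hscR : ∀ j, 1 ≤ j → j ≤ k → ∀ X, Sect2.admR (F.P p.K) θ.ν θ.τ9.M (gOfRecord₁₃ F N θ.toStage13Params p) s.Λ j (Sect2.domSites (F.P p.K) θ.τ9.M j X) = true →
      j ≤ scR j (pick j X) ∧ scR j (pick j X) ≤ k)
    (hr : ∀ j, 1 ≤ j → j ≤ k → ∀ X, Sect2.admR (F.P p.K) θ.ν θ.τ9.M (gOfRecord₁₃ F N θ.toStage13Params p) s.Λ j (Sect2.domSites (F.P p.K) θ.τ9.M j X) = true →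
      |(t.R j X (Sect2.ofBackgroundC (ιSU N) U)).re - (t.R j X (Sect2.ofBackgroundC (ιSU N) 1)).re| ≤
        cR * (L ^ ((j : ℝ) - scR j (pick j X))) ^ 4 * (gOfRecord₁₃ F N θ.toStage13Params p j) ^ κ₀ * Real.exp (-κ * (Sect2.domSys (F.P p.K) θ.τ9.M j).dj X))
    (hcountR : ∀ j, 1 ≤ j → j ≤ k → ∀ n, ((((univ.filter fun X => Sect2.admR (F.P p.K) θ.ν θ.τ9.M (gOfRecord₁₃ F N θ.toStage13Params p) s.Λ j
        (Sect2.domSites (F.P p.K) θ.τ9.M j X) = true).image (pick j)).filter (fun z => scR j z = n)).card : ℝ) ≤ (L ^ ((n : ℝ) - j)) ^ (4 : ℝ) * Γ n)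
    -- (𝐁) a class map + (2.47) per class
    (cls : (j : ℕ) → (Sect2.domSys (F.P p.K) θ.τ9.M j).Dom → ℕ)
    (hcls : ∀ j, 1 ≤ j → j ≤ k → ∀ X, Sect2.admB (F.P p.K) θ.ν θ.τ9.M (gOfRecord₁₃ F N θ.toStage13Params p) s.Ω s.Λ j (Sect2.domSites (F.P p.K) θ.τ9.M j X) = true →
      1 ≤ cls j X ∧ cls j X ≤ j)
    (V : ℕ → ℝ) (hV : ∀ n, 1 ≤ n → n ≤ k → 0 ≤ V n) (hVΓ : ∀ n, 1 ≤ n → n ≤ k → V n ≤ Γ n)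
    (h247 : ∀ n j, 1 ≤ n → n ≤ j → j ≤ k →
      |∑ X : (Sect2.domSys (F.P p.K) θ.τ9.M j).Dom,
          (if Sect2.admB (F.P p.K) θ.ν θ.τ9.M (gOfRecord₁₃ F N θ.toStage13Params p) s.Ω s.Λ j (Sect2.domSites (F.P p.K) θ.τ9.M j X) = true ∧ cls j X = n then
            (t.B j X (Sect2.ofBackgroundC (ιSU N) U) a).re else 0)| ≤ B₁ * (2 : ℝ) ^ (-((j : ℝ) - n)) * V n)
    -- the vacuum sentence
    (hvac : VacuumRestBound EkRest E₂ Γ k) :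
    Ineq249 ((sect2ActionDataOfRecord F N (FluctV N) p.K (settingOfRecord₁₃ F N θ.toStage13Params p) (θ.rzAt p s) s t a Ek).action23 k U)
      (smearedWilson (invSq (flowOfRun (gOfRecord₁₃ F N θ.toStage13Params p)) (θ.Phih p k s.Ω s.Λ) k) U) (-EkLog)
      (cE * (1 - L ^ (-(1 - b)))⁻¹ + 1 + 2 * B₁ + E₂) Γ k := by
  have hL0 : 0 < L := lt_trans zero_lt_one hL
  have hK : 0 ≤ K₀ (4 * 2 ^ (F.P p.K).d) (2 * (F.P p.K).d) := by unfold K₀; positivity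
  have hg : ∀ j, j ≤ k → 0 ≤ gOfRecord₁₃ F N θ.toStage13Params p j := fun j hj => (hI j (hj.trans hk)).1.le
  refine ineq249_action23_at_record₁₃CoPH_of_thm2_of_window θ p s t a κ₀ hκ Ek EkLog EkRest hEk U cE (cR * K₀ (4 * 2 ^ (F.P p.K).d) (2 * (F.P p.K).d)) B₁ L (1 - b) E₂ Γ
    hL (by linarith) hcE (mul_nonneg hcR hK) hΓ hb' hγ4 hγ2 hRγ hI hlb hk (fun j hj hjk => ?_) (fun j hj hjk => ?_) ?_ hvac
  · exact h243_at_record₁₃CoPH_of_perPoint θ p s t U j (Z j) (h j) (hφ j hj hjk) (hZ j hj hjk) (scE j) (hscE j hj hjk) hL0 hcE (h367 j hj hjk) Γ (hcountE j hj hjk)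
  · exact h244_at_record₁₃CoPH_of_perDomain θ p s t U j (pick j) (hpick j hj hjk) (scR j) (hscR j hj hjk) hκR hcR hL0 (hg j hjk) (hr j hj hjk) Γ (hcountR j hj hjk)
  · exact h248_at_record₁₃CoPH_of_ineq247 θ p s t a U cls hcls hB V Γ hV hVΓ h247

/-- **★★ Its constant-coupling upper half** (the Cor.-3 chain's currency «−(1∕g_k²)A(U)», `g_k = gOfRecord₁₃ … p k`), adding only `φ_j ≤ 1` for the history's cut-offs:
`A_k(s)(U) ≤ −(1∕g_k²)·A(U) − EkLog + (cE(1−L^{−(1−b)})⁻¹ + 1 + 2B₁ + E₂)·Σ_{n=1}^{k}Γ_n`. [cite: Balaban1988Convergent, (2.49)–(2.50) p.264, (2.24) p.259] -/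
theorem action23_at_record₁₃CoPH_le_of_sect3Sentences (s : SeqOfRecord F θ.ν θ.τ9.M (gOfRecord₁₃ F N θ.toStage13Params p) p.K k)
    (t : Sect2.TermValues (F.P p.K) (MatA N) (FluctV N) θ.τ9.M) (a : Tk.SFluct (F.P p.K) (FluctV N)) (κ₀ : ℕ) (hκ : 7 ≤ κ₀)
    (Ek EkLog EkRest : ℝ) (hEk : Ek = EkLog + EkRest) (U : GaugeField (F.P p.K) 0 (SU N)) (cE cR B₁ L b E₂ : ℝ) (Γ : ℕ → ℝ)
    (hL : 1 < L) (hb : b < 1) (hcE : 0 ≤ cE) (hcR : 0 ≤ cR) (hB : 0 ≤ B₁) (hΓ : ∀ n, 1 ≤ n → n ≤ k → 0 ≤ Γ n)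
    {γ b' : ℝ} {K' : ℕ} (hb' : 0 < b') (hγ4 : γ ^ 4 ≤ b') (hγ2 : γ ≤ 1 / 2)
    (hRγ : (cR * K₀ (4 * 2 ^ (F.P p.K).d) (2 * (F.P p.K).d)) * γ ^ (κ₀ - 6) ≤ 1)
    (hI : (genFlow (betaOfRecord₁₃ F N θ.toStage13Params) p.g0).InInterval γ K')
    (hlb : ∀ j, j < K' → b' ≤ 1 / gOfRecord₁₃ F N θ.toStage13Params p j ^ 2 - 1 / gOfRecord₁₃ F N θ.toStage13Params p (j + 1) ^ 2) (hk : k ≤ K')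
    (hφle : ∀ j, 1 ≤ j → j ≤ k → ∀ x, θ.Phih p k s.Ω s.Λ j x ≤ 1)
    (Z : (j : ℕ) → Finset (Site (F.P p.K) j)) (h : (j : ℕ) → Site (F.P p.K) j → Plaq (F.P p.K) 0 → ℝ)
    (hφ : ∀ j, 1 ≤ j → j ≤ k → ∀ q, θ.Phih p k s.Ω s.Λ j q = ∑ z ∈ Z j, h j z q)
    (hZ : ∀ j, 1 ≤ j → j ≤ k → ∀ z, z ∉ Z j → ∀ X, Sect2.admE (F.P p.K) θ.ν θ.τ9.M (gOfRecord₁₃ F N θ.toStage13Params p) s.Λ j (Sect2.domSites (F.P p.K) θ.τ9.M j X) z = false)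
    (scE : (j : ℕ) → Site (F.P p.K) j → ℕ) (hscE : ∀ j, 1 ≤ j → j ≤ k → ∀ z ∈ Z j, j ≤ scE j z ∧ scE j z ≤ k)
    (h367 : ∀ j, 1 ≤ j → j ≤ k → ∀ z ∈ Z j, |(∑ X : (Sect2.domSys (F.P p.K) θ.τ9.M j).Dom,
        (if Sect2.admE (F.P p.K) θ.ν θ.τ9.M (gOfRecord₁₃ F N θ.toStage13Params p) s.Λ j (Sect2.domSites (F.P p.K) θ.τ9.M j X) z then
          ((t.E j X z (gOfRecord₁₃ F N θ.toStage13Params p (j - 1)) (Sect2.ofBackgroundC (ιSU N) U)).re -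
            (t.E j X z (gOfRecord₁₃ F N θ.toStage13Params p (j - 1)) (Sect2.ofBackgroundC (ιSU N) 1)).re) else 0))
        - (1 / gOfRecord₁₃ F N θ.toStage13Params p (j - 1) ^ 2 - 1 / gOfRecord₁₃ F N θ.toStage13Params p j ^ 2) * smearedWilson (h j z) U| ≤
        cE * (L ^ ((j : ℝ) - scE j z)) ^ (5 - b))
    (hcountE : ∀ j, 1 ≤ j → j ≤ k → ∀ n, (((Z j).filter (fun z => scE j z = n)).card : ℝ) ≤ (L ^ ((n : ℝ) - j)) ^ (4 : ℝ) * Γ n)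
    {κ : ℝ} (hκR : kappa₀ (4 * 2 ^ (F.P p.K).d) (2 * (F.P p.K).d) ≤ κ)
    (pick : (j : ℕ) → (Sect2.domSys (F.P p.K) θ.τ9.M j).Dom → TPt (F.P p.K).d (Sect2.domCount (F.P p.K) θ.τ9.M j))
    (hpick : ∀ j, 1 ≤ j → j ≤ k → ∀ X, Sect2.admR (F.P p.K) θ.ν θ.τ9.M (gOfRecord₁₃ F N θ.toStage13Params p) s.Λ j (Sect2.domSites (F.P p.K) θ.τ9.M j X) = true → pick j X ∈ X.1)
    (scR : (j : ℕ) → TPt (F.P p.K).d (Sect2.domCount (F.P p.K) θ.τ9.M j) → ℕ)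
    (hscR : ∀ j, 1 ≤ j → j ≤ k → ∀ X, Sect2.admR (F.P p.K) θ.ν θ.τ9.M (gOfRecord₁₃ F N θ.toStage13Params p) s.Λ j (Sect2.domSites (F.P p.K) θ.τ9.M j X) = true →
      j ≤ scR j (pick j X) ∧ scR j (pick j X) ≤ k)
    (hr : ∀ j, 1 ≤ j → j ≤ k → ∀ X, Sect2.admR (F.P p.K) θ.ν θ.τ9.M (gOfRecord₁₃ F N θ.toStage13Params p) s.Λ j (Sect2.domSites (F.P p.K) θ.τ9.M j X) = true →
      |(t.R j X (Sect2.ofBackgroundC (ιSU N) U)).re - (t.R j X (Sect2.ofBackgroundC (ιSU N) 1)).re| ≤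
        cR * (L ^ ((j : ℝ) - scR j (pick j X))) ^ 4 * (gOfRecord₁₃ F N θ.toStage13Params p j) ^ κ₀ * Real.exp (-κ * (Sect2.domSys (F.P p.K) θ.τ9.M j).dj X))
    (hcountR : ∀ j, 1 ≤ j → j ≤ k → ∀ n, ((((univ.filter fun X => Sect2.admR (F.P p.K) θ.ν θ.τ9.M (gOfRecord₁₃ F N θ.toStage13Params p) s.Λ j
        (Sect2.domSites (F.P p.K) θ.τ9.M j X) = true).image (pick j)).filter (fun z => scR j z = n)).card : ℝ) ≤ (L ^ ((n : ℝ) - j)) ^ (4 : ℝ) * Γ n)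
    (cls : (j : ℕ) → (Sect2.domSys (F.P p.K) θ.τ9.M j).Dom → ℕ)
    (hcls : ∀ j, 1 ≤ j → j ≤ k → ∀ X, Sect2.admB (F.P p.K) θ.ν θ.τ9.M (gOfRecord₁₃ F N θ.toStage13Params p) s.Ω s.Λ j (Sect2.domSites (F.P p.K) θ.τ9.M j X) = true →
      1 ≤ cls j X ∧ cls j X ≤ j)
    (V : ℕ → ℝ) (hV : ∀ n, 1 ≤ n → n ≤ k → 0 ≤ V n) (hVΓ : ∀ n, 1 ≤ n → n ≤ k → V n ≤ Γ n)
    (h247 : ∀ n j, 1 ≤ n → n ≤ j → j ≤ k →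
      |∑ X : (Sect2.domSys (F.P p.K) θ.τ9.M j).Dom,
          (if Sect2.admB (F.P p.K) θ.ν θ.τ9.M (gOfRecord₁₃ F N θ.toStage13Params p) s.Ω s.Λ j (Sect2.domSites (F.P p.K) θ.τ9.M j X) = true ∧ cls j X = n then
            (t.B j X (Sect2.ofBackgroundC (ιSU N) U) a).re else 0)| ≤ B₁ * (2 : ℝ) ^ (-((j : ℝ) - n)) * V n)
    (hvac : VacuumRestBound EkRest E₂ Γ k) :
    (sect2ActionDataOfRecord F N (FluctV N) p.K (settingOfRecord₁₃ F N θ.toStage13Params p) (θ.rzAt p s) s t a Ek).action23 k U ≤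
      -(1 / (gOfRecord₁₃ F N θ.toStage13Params p k) ^ 2 * wilsonAction4 U) - EkLog + (cE * (1 - L ^ (-(1 - b)))⁻¹ + 1 + 2 * B₁ + E₂) * ∑ n ∈ Icc 1 k, Γ n := by
  have hL0 : 0 < L := lt_trans zero_lt_one hL
  have hK : 0 ≤ K₀ (4 * 2 ^ (F.P p.K).d) (2 * (F.P p.K).d) := by unfold K₀; positivity
  have hg : ∀ j, j ≤ k → 0 ≤ gOfRecord₁₃ F N θ.toStage13Params p j := fun j hj => (hI j (hj.trans hk)).1.le
  refine action23_at_record₁₃CoPH_le_of_thm2_of_window θ p s t a κ₀ hκ Ek EkLog EkRest hEk U cE (cR * K₀ (4 * 2 ^ (F.P p.K).d) (2 * (F.P p.K).d)) B₁ L (1 - b) E₂ Γ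
    hL (by linarith) hcE (mul_nonneg hcR hK) hΓ hb' hγ4 hγ2 hRγ hI hlb hk hφle (fun j hj hjk => ?_) (fun j hj hjk => ?_) ?_ hvac
  · exact h243_at_record₁₃CoPH_of_perPoint θ p s t U j (Z j) (h j) (hφ j hj hjk) (hZ j hj hjk) (scE j) (hscE j hj hjk) hL0 hcE (h367 j hj hjk) Γ (hcountE j hj hjk)
  · exact h244_at_record₁₃CoPH_of_perDomain θ p s t U j (pick j) (hpick j hj hjk) (scR j) (hscR j hj hjk) hκR hcR hL0 (hg j hjk) (hr j hj hjk) Γ (hcountR j hj hjk)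
  · exact h248_at_record₁₃CoPH_of_ineq247 θ p s t a U cls hcls hB V Γ hV hVΓ h247

end Summit.QuantumFields.YangMills.Theorems.BalabanUVNodesN11Thm2Ineq249AtRecord13CoPHOfSect3Sentences

end
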